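import Summits.Schanuel.Schanuel.Theorems.RigidCoreSparsityTwoOfAtoms
import Summits.Schanuel.Schanuel.Theorems.RigidCoreSparsityTwoBakerDepthCap

/-!
# Atom A2 ⟺ its Baker-shallow residual; the crux ⟺ A3 ∧ A2-shallow ∧ A1 (lead c3)

Line `cusp-germ-schneider-sparsity` of the crux `RigidCore.SparsityTwo` (item stmt-Schanuel-0971).  With the Baker depth cap
of the linear cusp LANDED (`linearCusp_bakerDepthCap`, `RigidCoreSparsityTwoBakerDepthCap`, over the pocket
`stub_bakerDepthCapRay` and the tree's proved quantitative Baker theorem `baker1975_thm_3_1_holds`), the inhomogeneous atom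
`InhomogeneousCuspAtom` (A2) is EQUIVALENT to its residual at Baker-bounded depth `InhomogeneousCuspAtomShallow`
(`RigidCoreSparsityTwoDefs`): `inhomogeneousCuspAtom_iff_shallow`.  Hence the crux is equivalent to the conjunction of the wild
atom, the SHALLOW inhomogeneous atom and the (Roth-capped) torsion-homogeneous linear atom: `sparsityTwo_iff_namedAtoms_shallow`
(registered stubs; `sparsityTwo_iff_namedAtoms` is `RigidCoreSparsityTwoOfAtoms`).  No unproved facts; axioms standard.
-/

set_option linter.dupNamespace false

namespace Summit.Schanuel.Schanuel.Cruxes.SparsityTwo.CuspGermSchneiderSparsity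

/-- **A2 ⟺ A2 at Baker-bounded depth** (registered stub `inhomogeneousCuspAtom_iff_shallow`).  `→`: ignore the depth data
(`inhomogeneousCuspAtomShallow_of_atom`).  `←`: given A2 data, take the datum's Baker cap `K` (`linearCusp_bakerDepthCap`); a
defect germ flat to order `K` has finitely many independent hits by the cap, otherwise the data are shallow and the residual
applies. -/
theorem inhomogeneousCuspAtom_iff_shallow : InhomogeneousCuspAtom ↔ InhomogeneousCuspAtomShallow := by
  refine ⟨inhomogeneousCuspAtomShallow_of_atom, fun h D G β hG hlin hβ hGalg hirr hnc htor => ?_⟩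
  obtain ⟨K, hK⟩ := linearCusp_bakerDepthCap D G β hG hlin hβ hGalg hirr
  by_cases hflat : ∀ j : ℕ, 1 ≤ j → j ≤ K → iteratedDeriv j (D.defectGerm β G) 0 = 0
  · exact hK hflat
  · push Not at hflat
    obtain ⟨j, hj1, hjK, hj⟩ := hflat
    exact h D G β K hG hlin hβ hGalg hirr hnc htor hK ⟨j, hj1, hjK, hj⟩

/-- **The crux ⟺ A3 ∧ A2-shallow ∧ A1** (registered stub `sparsityTwo_iff_namedAtoms_shallow`): the equivalence
`sparsityTwo_iff_namedAtoms` with the Baker depth cap folded into the inhomogeneous atom. -/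
theorem sparsityTwo_iff_namedAtoms_shallow : Summit.Schanuel.Schanuel.Theses.RigidCore.SparsityTwo ↔ WildCuspAtom ∧ InhomogeneousCuspAtomShallow ∧ LinearCuspAtom := by
  rw [sparsityTwo_iff_namedAtoms, inhomogeneousCuspAtom_iff_shallow]

/-- The three residual atoms — wild, shallow inhomogeneous, Roth-capped linear — imply the crux (curried corollary). -/
theorem sparsityTwo_of_namedAtoms_shallow (hA3 : WildCuspAtom) (hA2 : InhomogeneousCuspAtomShallow)
    (hA1 : LinearCuspAtom) : Summit.Schanuel.Schanuel.Theses.RigidCore.SparsityTwo :=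
  sparsityTwo_iff_namedAtoms_shallow.2 ⟨hA3, hA2, hA1⟩

end Summit.Schanuel.Schanuel.Cruxes.SparsityTwo.CuspGermSchneiderSparsity
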